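import Summits.QuantumFields.YangMills.Theorems.FemtoTransferGapRungW1upAlgebra
import Literature.MathematicalPhysics.QuantumLattice.SU2Haar

/-!
# Femto transfer gap — rung W1-up, part 2/7: the one-link weight, its moments and Haar ball volumes

Support module of the `FemtoTransferGap` group (cell `ym-beyond`, seat P1; route `LuscherReduction`, crux `OneSiteLevels` =
`stmt-QuantumFields-20007`), part 2/7 of the sorry-free proof of the registered BC5 rung `RungUpperK1` (`stub_rungW1up`):
`∃ C B0, ∀ B ≥ B0, e^{−C λ_b(B)} λ₀(B,1) ≤ λ₁(B,1)` on the ONE-SITE lattice (`rungUpperK1` in `FemtoTransferGapRungW1up`).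

The diagonal subgroup `diagSU2 θ` and `exists_vacDist_eq` (every `t ∈ [0,2]` is a value of `vacDist`); the ONE-LINK WEIGHT
`w_B(W) = e^{B Re tr W}` (`linkW`), its mass `c_B = ∫ w_B` (`linkC`) and second moment `M₂ = ∫ ‖W − 1‖_F² w_B` (`linkM2`) with the
pinned-Laplace bound `M₂ ≤ (cM2/B) c_B` (`linkM2_le`, from `integral_sq_mul_exp_neg_le_of_two_sided`); Haar volumes of Frobenius balls
(`ballVol`): positivity, translation invariance, doubling `ballVol(2ρ) ≤ 5⁸ ballVol ρ`, and `σ{vacDist ≤ ρ} ≤ 2 ballVol ρ`.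

## WHAT THIS IS NOT
NOT THE CLAY GAP; no statement about `L → ∞` or a continuum limit.  Everything below is proved (no `sorry`, no new axiom).
-/

set_option autoImplicit false

noncomputable section

open MeasureTheory Filter Topology Real
open scoped Matrix ComplexConjugate
open Literature.MathematicalPhysics.QuantumFieldTheory
open Literature.MathematicalPhysics.QuantumLattice

namespace Summit.QuantumFields.YangMills.Theorems.FemtoTransferGap
/-! ### §4. The diagonal subgroup and prescribed values of `vacDist` -/

/-- `diag(e^{iθ}, e^{−iθ}) ∈ SU(2)`. [folklore] -/
def diagSU2 (θ : ℝ) : SU2 :=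
  ⟨!![Complex.exp (θ * Complex.I), 0; 0, Complex.exp (-(θ * Complex.I))], by
    have hs1 : conj (Complex.exp (θ * Complex.I)) = Complex.exp (-(θ * Complex.I)) := by
      rw [← Complex.exp_conj, map_mul, Complex.conj_ofReal, Complex.conj_I, mul_neg]
    have hs2 : conj (Complex.exp (-(θ * Complex.I))) = Complex.exp (θ * Complex.I) := by
      rw [← Complex.exp_conj, map_neg, map_mul, Complex.conj_ofReal, Complex.conj_I, mul_neg, neg_neg]
    have hm : Complex.exp (θ * Complex.I) * Complex.exp (-(θ * Complex.I)) = 1 := by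
      rw [← Complex.exp_add, add_neg_cancel, Complex.exp_zero]
    have hm' : Complex.exp (-(θ * Complex.I)) * Complex.exp (θ * Complex.I) = 1 := by rw [mul_comm]; exact hm
    rw [Matrix.mem_specialUnitaryGroup_iff, Matrix.mem_unitaryGroup_iff]
    refine ⟨?_, ?_⟩
    · ext i j
      fin_cases i <;> fin_cases j <;>
        simp [Matrix.mul_apply, Fin.sum_univ_two, Matrix.star_eq_conjTranspose, Matrix.conjTranspose_apply, hs1, hs2,
          hm, hm']
    · simp [Matrix.det_fin_two_of, hm]⟩

/-- `‖diag(e^{iθ}, e^{−iθ}) − 1‖_F² = 4 (1 − cos θ)`. [folklore] -/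
theorem frobNorm_diagSU2_sub_one_sq (θ : ℝ) :
    frobNorm (((diagSU2 θ : SU2) : Matrix (Fin 2) (Fin 2) ℂ) - 1) ^ 2 = 4 * (1 - Real.cos θ) := by
  rw [frobNorm_sub_one_sq]
  have htr : (((diagSU2 θ : SU2) : Matrix (Fin 2) (Fin 2) ℂ).trace).re = 2 * Real.cos θ := by
    simp only [diagSU2, Matrix.trace_fin_two_of, Complex.add_re]
    rw [Complex.exp_ofReal_mul_I_re, show -(θ * Complex.I) = ((-θ : ℝ) : ℂ) * Complex.I by push_cast; ring,
      Complex.exp_ofReal_mul_I_re, Real.cos_neg]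
    ring
  rw [htr]; ring

/-- **Every value in `[0, 2]` is a distance to the centre**: for `0 ≤ t ≤ 2` there is `W ∈ SU(2)` with `vacDist W = ‖W − 1‖_F = t`
(`W = diag(e^{iθ}, e^{−iθ})`, `cos θ = 1 − t²/4`). [folklore] -/
theorem exists_vacDist_eq {t : ℝ} (h0 : 0 ≤ t) (h2 : t ≤ 2) :
    ∃ W : SU2, vacDist W = t ∧ frobNorm ((W : Matrix (Fin 2) (Fin 2) ℂ) - 1) = t := by
  set θ : ℝ := Real.arccos (1 - t ^ 2 / 4) with hθ
  have hc : Real.cos θ = 1 - t ^ 2 / 4 := by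
    rw [hθ, Real.cos_arccos] <;> nlinarith
  have hsq : frobNorm (((diagSU2 θ : SU2) : Matrix (Fin 2) (Fin 2) ℂ) - 1) ^ 2 = t ^ 2 := by
    rw [frobNorm_diagSU2_sub_one_sq, hc]; ring
  have hd : frobNorm (((diagSU2 θ : SU2) : Matrix (Fin 2) (Fin 2) ℂ) - 1) = t :=
    (sq_eq_sq₀ (frobNorm_nonneg _) h0).1 hsq
  refine ⟨diagSU2 θ, ?_, hd⟩
  have hplus : t ≤ frobNorm (((diagSU2 θ : SU2) : Matrix (Fin 2) (Fin 2) ℂ) + 1) := by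
    have h8 := frobNorm_add_one_sq_eq (diagSU2 θ)
    rw [hsq] at h8
    refine le_of_pow_le_pow_left₀ two_ne_zero (frobNorm_nonneg _) ?_
    rw [h8]; nlinarith
  unfold vacDist
  rw [hd]
  exact min_eq_left hplus




/-! ## Part B. The one-link kernel

`σ = haarProbability SU2`; one-link Boltzmann weight `w_B(W) = exp(B · Re tr W)`; `c_B = ∫ w_B dσ`; second moment
`M₂(B) = ∫ ‖W − 1‖_F² w_B dσ ≤ (cM2 / B) c_B` (Laplace-type bound, doubling + convexity, from `PinnedOneLinkLaplaceIntegrals`);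
the one-link bilinear form `q_B(g,h) = ∫∫ g(u) w_B(u v⁻¹) h(v) dσ dσ` with its MARKOV-DEFICIT IDENTITY
`c_B ∫ g² − q_B(g,g) = ½ ∫∫ w_B(u v⁻¹) (g u − g v)²`, the Lipschitz deficit bound and the separated-support (tail) bound;
Haar volumes of Hilbert–Schmidt balls (`ballVol`), positivity and doubling. -/

/-- `W ↦ Re tr W` is continuous on `SU(2)`. [folklore] -/
theorem continuous_reTrace : Continuous fun W : SU2 => ((W : Matrix (Fin 2) (Fin 2) ℂ).trace).re :=
  Complex.continuous_re.comp continuous_subtype_val.matrix_trace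

/-- **One-link Boltzmann weight** `w_B(W) = exp(B · Re tr W)` (the time-like plaquette weight of the transfer kernel, one link).
[cite: SeilerLNP1982, §3] -/
def linkW (B : ℝ) (W : SU2) : ℝ := Real.exp (B * ((W : Matrix (Fin 2) (Fin 2) ℂ).trace).re)

/-- `0 < w_B`. [folklore] -/
theorem linkW_pos (B : ℝ) (W : SU2) : 0 < linkW B W := Real.exp_pos _

/-- `w_B` is continuous. [folklore] -/
theorem continuous_linkW (B : ℝ) : Continuous (linkW B) :=
  Real.continuous_exp.comp (continuous_const.mul continuous_reTrace)

/-- `w_B` is measurable. [folklore] -/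
theorem measurable_linkW (B : ℝ) : Measurable (linkW B) := (continuous_linkW B).measurable

/-- `w_B ≤ e^{2B}` for `B ≥ 0`. [folklore] -/
theorem linkW_le {B : ℝ} (hB : 0 ≤ B) (W : SU2) : linkW B W ≤ Real.exp (2 * B) := by
  unfold linkW; refine Real.exp_le_exp.2 ?_; have := re_trace_le_two W; nlinarith

/-- `e^{−2B} ≤ w_B` for `B ≥ 0`. [folklore] -/
theorem exp_neg_le_linkW {B : ℝ} (hB : 0 ≤ B) (W : SU2) : Real.exp (-(2 * B)) ≤ linkW B W := by
  unfold linkW; refine Real.exp_le_exp.2 ?_; have := neg_two_le_re_trace W; nlinarith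

/-- `|w_B| ≤ e^{2B}` for `B ≥ 0`. [folklore] -/
theorem abs_linkW_le {B : ℝ} (hB : 0 ≤ B) (W : SU2) : |linkW B W| ≤ Real.exp (2 * B) := by
  rw [abs_of_pos (linkW_pos B W)]; exact linkW_le hB W

/-- `Re tr W⁻¹ = Re tr W` on `SU(2)`. [folklore] -/
theorem re_trace_inv (W : SU2) :
    (((W⁻¹ : SU2) : Matrix (Fin 2) (Fin 2) ℂ).trace).re = ((W : Matrix (Fin 2) (Fin 2) ℂ).trace).re := by
  rw [← Matrix.star_eq_inv, Matrix.specialUnitaryGroup.coe_star, Matrix.star_eq_conjTranspose,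
    Matrix.trace_conjTranspose, Complex.star_def, Complex.conj_re]

/-- `w_B(W⁻¹) = w_B(W)`. [folklore] -/
theorem linkW_inv (B : ℝ) (W : SU2) : linkW B W⁻¹ = linkW B W := by
  unfold linkW; rw [re_trace_inv]

/-- `w_B(v u⁻¹) = w_B(u v⁻¹)` (symmetry of the one-link kernel). [folklore] -/
theorem linkW_symm (B : ℝ) (u v : SU2) : linkW B (v * u⁻¹) = linkW B (u * v⁻¹) := by
  rw [← linkW_inv B (u * v⁻¹), mul_inv_rev, inv_inv]

/-- `∫ f(u v⁻¹) dσ(v) = ∫ f dσ` (inversion + left invariance). [folklore] -/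
theorem integral_comp_mul_inv_left (f : SU2 → ℝ) (u : SU2) :
    ∫ v, f (u * v⁻¹) ∂haarProbability SU2 = ∫ v, f v ∂haarProbability SU2 := by
  simpa using integral_haar_conj_inv_eq f u 1

/-- `∫ f(u v⁻¹) dσ(u) = ∫ f dσ` (right invariance). [folklore] -/
theorem integral_comp_mul_inv_right (f : SU2 → ℝ) (v : SU2) :
    ∫ u, f (u * v⁻¹) ∂haarProbability SU2 = ∫ u, f u ∂haarProbability SU2 :=
  integral_mul_right_eq_self f v⁻¹

/-- **One-link partition function** `c_B = ∫ w_B dσ`. [folklore] -/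
def linkC (B : ℝ) : ℝ := ∫ W, linkW B W ∂haarProbability SU2

/-- **One-link second moment** `M₂(B) = ∫ ‖W − 1‖_F² w_B(W) dσ`. [folklore] -/
def linkM2 (B : ℝ) : ℝ := ∫ W, frobNorm ((W : Matrix (Fin 2) (Fin 2) ℂ) - 1) ^ 2 * linkW B W ∂haarProbability SU2

/-- `w_B` is integrable (`B ≥ 0`). [folklore] -/
theorem integrable_linkW {B : ℝ} (hB : 0 ≤ B) : Integrable (linkW B) (haarProbability SU2) :=
  integrable_of_measurable_abs_le _ (measurable_linkW B) (abs_linkW_le hB)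

/-- `e^{−2B} ≤ c_B` (`B ≥ 0`). [folklore] -/
theorem exp_neg_le_linkC {B : ℝ} (hB : 0 ≤ B) : Real.exp (-(2 * B)) ≤ linkC B := by
  have h := integral_mono (integrable_const (Real.exp (-(2 * B)))) (integrable_linkW hB) (exp_neg_le_linkW hB)
  simpa [linkC] using h

/-- `0 < c_B` (`B ≥ 0`). [folklore] -/
theorem linkC_pos {B : ℝ} (hB : 0 ≤ B) : 0 < linkC B := lt_of_lt_of_le (Real.exp_pos _) (exp_neg_le_linkC hB)

/-- `c_B ≤ e^{2B}` (`B ≥ 0`). [folklore] -/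
theorem linkC_le {B : ℝ} (hB : 0 ≤ B) : linkC B ≤ Real.exp (2 * B) := by
  have h := integral_mono (integrable_linkW hB) (integrable_const (Real.exp (2 * B))) (linkW_le hB)
  simpa [linkC] using h

/-- `0 ≤ M₂(B)`. [folklore] -/
theorem linkM2_nonneg (B : ℝ) : 0 ≤ linkM2 B :=
  integral_nonneg fun W => mul_nonneg (sq_nonneg _) (linkW_pos B W).le

/-- `|‖W − 1‖² w_B| ≤ 8 e^{2B}`. [folklore] -/
theorem abs_sq_mul_linkW_le {B : ℝ} (hB : 0 ≤ B) (W : SU2) :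
    |frobNorm ((W : Matrix (Fin 2) (Fin 2) ℂ) - 1) ^ 2 * linkW B W| ≤ 8 * Real.exp (2 * B) := by
  rw [abs_mul, abs_of_nonneg (sq_nonneg _), abs_of_pos (linkW_pos B W)]
  exact mul_le_mul (frobNorm_sub_one_sq_le_eight W) (linkW_le hB W) (linkW_pos B W).le (by norm_num)

/-- The second-moment integrand is measurable. [folklore] -/
theorem measurable_sq_mul_linkW (B : ℝ) :
    Measurable fun W : SU2 => frobNorm ((W : Matrix (Fin 2) (Fin 2) ℂ) - 1) ^ 2 * linkW B W :=
  ((continuous_frobNorm'.comp (continuous_subtype_val.sub continuous_const)).pow 2).measurable.mul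
    (measurable_linkW B)

/-- The constant of the second-moment bound, `cM2 = 4 · (5^8)² / (3/2) = (8/3) 5^{16}`. [folklore] -/
def cM2 : ℝ := 4 * ((5 : ℝ) ^ (2 * 2 ^ 2)) ^ (1 + 1) / (3 * (1 / 2))

/-- `0 < cM2`. [folklore] -/
theorem cM2_pos : 0 < cM2 := by unfold cM2; positivity

/-- **Second-moment bound** `M₂(B) ≤ (cM2 / B) · c_B` for `B > 0`: under the one-link Gibbs weight the mean of `‖W − 1‖_F²` is `O(1/B)`
(`integral_sq_mul_exp_neg_le_of_two_sided` with `F = 2 − Re tr = ‖W − 1‖_F²/2`, `a = 1/2`, `k = 1`). [folklore] -/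
theorem linkM2_le {B : ℝ} (hB : 0 < B) : linkM2 B ≤ cM2 / B * linkC B := by
  set F : SU2 → ℝ := fun W => 2 - ((W : Matrix (Fin 2) (Fin 2) ℂ).trace).re with hF
  have hFc : Continuous F := continuous_const.sub continuous_reTrace
  have hd : ∀ g : SU2, frobNorm (su2Rep g - su2Rep 1) = frobNorm ((g : Matrix (Fin 2) (Fin 2) ℂ) - 1) := by
    intro g; simp
  have hFeq : ∀ g : SU2, F g = frobNorm ((g : Matrix (Fin 2) (Fin 2) ℂ) - 1) ^ 2 / 2 := fun g => two_sub_re_trace_eq g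
  have hlo : ∀ g : SU2, (1 / 2 : ℝ) * frobNorm (su2Rep g - su2Rep 1) ^ 2 ≤ F g := by
    intro g; rw [hd, hFeq]; linarith
  have hhi : ∀ g : SU2, F g ≤ 2 * frobNorm (su2Rep g - su2Rep 1) ^ 2 := by
    intro g; rw [hd, hFeq]; nlinarith [sq_nonneg (frobNorm ((g : Matrix (Fin 2) (Fin 2) ℂ) - 1))]
  have key := integral_sq_mul_exp_neg_le_of_two_sided su2Rep continuous_su2Rep su2_mem_unitaryGroup 1 hFc
    (a := 1 / 2) (s := B) (by norm_num) hB (k := 1) (by norm_num) hlo hhi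
  have h1 : ∀ g : SU2, Real.exp (-B * F g) = Real.exp (-(2 * B)) * linkW B g := by
    intro g
    rw [hF, linkW, ← Real.exp_add]
    congr 1; ring
  have hL : ∫ g, frobNorm (su2Rep g - su2Rep 1) ^ 2 * Real.exp (-B * F g) ∂haarProbability SU2 =
      Real.exp (-(2 * B)) * linkM2 B := by
    rw [linkM2, ← integral_const_mul]
    refine integral_congr_ae (ae_of_all _ fun g => ?_)
    simp only
    rw [hd, h1]; ring
  have hR : ∫ g, Real.exp (-B * F g) ∂haarProbability SU2 = Real.exp (-(2 * B)) * linkC B := by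
    rw [linkC, ← integral_const_mul]
    exact integral_congr_ae (ae_of_all _ fun g => h1 g)
  rw [hL, hR] at key
  have hc : 4 * ((5 : ℝ) ^ (2 * 2 ^ 2)) ^ (1 + 1) / (3 * (1 / 2) * B) = cM2 / B := by
    rw [cM2, div_mul_eq_div_div]
  rw [hc] at key
  have key' : Real.exp (-(2 * B)) * linkM2 B ≤ Real.exp (-(2 * B)) * (cM2 / B * linkC B) := by
    calc Real.exp (-(2 * B)) * linkM2 B ≤ cM2 / B * (Real.exp (-(2 * B)) * linkC B) := key
      _ = Real.exp (-(2 * B)) * (cM2 / B * linkC B) := by ring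
  exact le_of_mul_le_mul_left key' (Real.exp_pos _)

/-! ### B.2 Haar volumes of Hilbert–Schmidt balls -/

/-- `ballVol r = σ{‖W − 1‖_F ≤ r}`, the Haar probability of the closed Hilbert–Schmidt ball about `1`. [folklore] -/
def ballVol (r : ℝ) : ℝ := (haarProbability SU2).real {W : SU2 | frobNorm ((W : Matrix (Fin 2) (Fin 2) ℂ) - 1) ≤ r}

/-- `0 ≤ ballVol r`. [folklore] -/
theorem ballVol_nonneg (r : ℝ) : 0 ≤ ballVol r := measureReal_nonneg

/-- **Balls have positive Haar measure**: `0 < ballVol r` for `r > 0` (Haar measure charges open sets). [folklore] -/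
theorem ballVol_pos {r : ℝ} (hr : 0 < r) : 0 < ballVol r := by
  have hopen : IsOpen {W : SU2 | frobNorm ((W : Matrix (Fin 2) (Fin 2) ℂ) - 1) < r} :=
    isOpen_lt (continuous_frobNorm'.comp (continuous_subtype_val.sub continuous_const)) continuous_const
  have hne : ({W : SU2 | frobNorm ((W : Matrix (Fin 2) (Fin 2) ℂ) - 1) < r}).Nonempty :=
    ⟨1, by simp [frobNorm_zero, hr]⟩
  have hpos := hopen.measure_pos (haarProbability SU2) hne
  have hsub : {W : SU2 | frobNorm ((W : Matrix (Fin 2) (Fin 2) ℂ) - 1) < r} ⊆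
      {W : SU2 | frobNorm ((W : Matrix (Fin 2) (Fin 2) ℂ) - 1) ≤ r} := by
    intro W hW
    simp only [Set.mem_setOf_eq] at hW ⊢
    exact hW.le
  have hpos' := lt_of_lt_of_le hpos (measure_mono hsub)
  exact ENNReal.toReal_pos hpos'.ne' (measure_ne_top _ _)

/-- `ballVol` is monotone. [folklore] -/
theorem ballVol_mono {r s : ℝ} (h : r ≤ s) : ballVol r ≤ ballVol s :=
  measureReal_mono (fun W hW => le_trans hW h)

/-- All Hilbert–Schmidt balls of the same radius have the same Haar measure. [folklore] -/
theorem ballVol_shift (W₀ : SU2) (r : ℝ) :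
    (haarProbability SU2).real
        {W : SU2 | frobNorm ((W : Matrix (Fin 2) (Fin 2) ℂ) - (W₀ : Matrix (Fin 2) (Fin 2) ℂ)) ≤ r} =
      ballVol r := by
  have h := haar_frobBall_eq su2Rep su2_mem_unitaryGroup 1 W₀ r
  simp only [fundamentalRep_apply, OneMemClass.coe_one] at h
  unfold ballVol Measure.real
  rw [h]

/-- The ball about `−1` has the same measure as the ball about `1`. [folklore] -/
theorem ballVol_neg (r : ℝ) :
    (haarProbability SU2).real {W : SU2 | frobNorm ((W : Matrix (Fin 2) (Fin 2) ℂ) + 1) ≤ r} = ballVol r := by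
  have h := ballVol_shift negOne r
  simp only [coe_negOne, sub_neg_eq_add] at h
  exact h

/-- **Doubling**: `ballVol (2r) ≤ 5⁸ ballVol r` (`r ≥ 0`). [folklore] -/
theorem ballVol_two_mul_le {r : ℝ} (hr : 0 ≤ r) : ballVol (2 * r) ≤ 5 ^ 8 * ballVol r := by
  have h := haar_frobBall_two_mul_le su2Rep continuous_su2Rep su2_mem_unitaryGroup 1 hr
  simp only [fundamentalRep_apply, OneMemClass.coe_one] at h
  unfold ballVol Measure.real
  have h' := ENNReal.toReal_mono (ENNReal.mul_ne_top (by simp) (measure_ne_top _ _)) h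
  rw [ENNReal.toReal_mul] at h'
  norm_num at h' ⊢
  exact h'

/-- Iterated doubling: `ballVol (2^k r) ≤ (5⁸)^k ballVol r`. [folklore] -/
theorem ballVol_pow_mul_le {r : ℝ} (hr : 0 ≤ r) (k : ℕ) : ballVol (2 ^ k * r) ≤ (5 ^ 8) ^ k * ballVol r := by
  induction k with
  | zero => simp
  | succ k ih =>
    calc ballVol (2 ^ (k + 1) * r) = ballVol (2 * (2 ^ k * r)) := by rw [pow_succ]; ring_nf
      _ ≤ 5 ^ 8 * ballVol (2 ^ k * r) := ballVol_two_mul_le (by positivity)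
      _ ≤ 5 ^ 8 * ((5 ^ 8) ^ k * ballVol r) := mul_le_mul_of_nonneg_left ih (by positivity)
      _ = (5 ^ 8) ^ (k + 1) * ballVol r := by rw [pow_succ]; ring

/-- The set `{vacDist ≤ ρ}` is measurable (closed). [folklore] -/
theorem measurableSet_vacDist_le (ρ : ℝ) : MeasurableSet {W : SU2 | vacDist W ≤ ρ} :=
  (isClosed_le continuous_vacDist continuous_const).measurableSet

/-- `σ{vacDist ≤ ρ} ≤ 2 ballVol ρ` (union of the balls about `±1`). [folklore] -/
theorem vacSet_real_le (ρ : ℝ) : (haarProbability SU2).real {W : SU2 | vacDist W ≤ ρ} ≤ 2 * ballVol ρ := by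
  have hsub : {W : SU2 | vacDist W ≤ ρ} ⊆ {W : SU2 | frobNorm ((W : Matrix (Fin 2) (Fin 2) ℂ) - 1) ≤ ρ} ∪
      {W : SU2 | frobNorm ((W : Matrix (Fin 2) (Fin 2) ℂ) + 1) ≤ ρ} := by
    intro W hW
    simp only [Set.mem_setOf_eq, vacDist, min_le_iff] at hW
    rcases hW with h | h
    · exact Or.inl h
    · exact Or.inr h
  calc (haarProbability SU2).real {W : SU2 | vacDist W ≤ ρ}
      ≤ (haarProbability SU2).real ({W : SU2 | frobNorm ((W : Matrix (Fin 2) (Fin 2) ℂ) - 1) ≤ ρ} ∪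
          {W : SU2 | frobNorm ((W : Matrix (Fin 2) (Fin 2) ℂ) + 1) ≤ ρ}) := measureReal_mono hsub
    _ ≤ (haarProbability SU2).real {W : SU2 | frobNorm ((W : Matrix (Fin 2) (Fin 2) ℂ) - 1) ≤ ρ} +
          (haarProbability SU2).real {W : SU2 | frobNorm ((W : Matrix (Fin 2) (Fin 2) ℂ) + 1) ≤ ρ} :=
        measureReal_union_le _ _
    _ = 2 * ballVol ρ := by rw [ballVol_neg, ballVol]; ring

end Summit.QuantumFields.YangMills.Theorems.FemtoTransferGap

end
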